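import Literature.Probability.Percolation.TriLowestCrossing
import Literature.Probability.Percolation.TriAnnulusCircuit
import Literature.Probability.Percolation.ArmSeparationNonvacuity
import HarnessLib

/-!
# The inner half-annulus of `𝕋` as a `JDomain`: the exploration region for INTERNAL extremities

Topic: Probability / Percolation; family `crit-perc`. A brick of the discharge of
`Literature.Probability.Percolation.Nolin2008_twoArm_separation` (Nolin 2008, Thm. 11 [arXiv 0711.4948: Thm. 10];
`ArmSeparation.lean`). The abstract lowest-crossing toolkit `JDomain` (`TriLowestCrossing.lean`)
needs, for each concrete exploration region, the two planar hypotheses `JDomain.CutProp` and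
`JDomain.DualProp`. For the EXTERNAL extremities (tips on a side of the outer hexagon `∂Λ_{2M}`)
this is done by the boundary trapezoid `trapDomain M` of `ArmSeparationTrapezoid.lean`, which is
the region the discharge consumes for the outer boundary. For the INTERNAL extremities (tips on a
side of the inner hexagon `∂Λ_m`, arms leaving `Λ_m` outwards; Nolin 2008, §4.4, "2. Internal
extremities", the regions `U^{i,int}_N` "having the same shapes as the `U^{i,ext}` but with
different parts of the boundary distinguished") no trapezoid or parallelogram works: an arm
leaving the side `x₀ = m` may turn around either corner of `Λ_m` before reaching `|·|_𝕋 = 2m`, so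
the region must contain the two neighbouring sectors. This file provides that region, the
**right half-annulus**

  `HA(m) = {x : 0 ≤ x₀, m ≤ |x|_𝕋 ≤ 2m}`      (`HalfAnnulus.haSet m`, `|·|_𝕋 = triNorm`),

bounded by the inner sides `6, 1, 2` of `∂Λ_m`, the outer sides `6, 1, 2` of `∂Λ_{2m}` and the two
cut rays `{x₀ = 0, m ≤ |x₁| ≤ 2m}`, as the `JDomain` `HalfAnnulus.intDom m` with

* tip arc `J = {(m, y) : -m+2 ≤ y ≤ -2}` (the inner side `1` without its two extreme sites at each
  end; `HalfAnnulus.IsIntJ`), ordered by the height `x ↦ x₁`;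
* start set `F` = the outer boundary `{|x|_𝕋 = 2m}` together with the cut rays `{x₀ = 0}` (an arm
  of `armEvent` from `∂Λ_m`, cut at its last visit to `∂Λ_m` and stopped when it first leaves
  `{x₀ ≥ 1, |x|_𝕋 ≤ 2m - 1}`, is — reversed — a crossing from `F` to `J` when its tip lies on `J`);
* lower reference arc `Bt` = inner side `6` and the three lowest sites of the inner side `1`
  (`HalfAnnulus.IsIntBt`), upper reference arc `Tp` = inner side `2` and the three highest sites of
  the inner side `1` (`HalfAnnulus.IsIntTp`); the end sites of `J` also belong to `Bt`/`Tp`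
  (harmless for the toolkit, and forced: the inner hexagon site next to the junction of two arcs
  neighbours both),

and proves `HalfAnnulus.intDom_dualProp` and `HalfAnnulus.intDom_cutProp` (for `5 ≤ m`), from the
set-level statements `HalfAnnulus.int_dual`, `HalfAnnulus.int_cut`. Both are REDUCED to the
parallelogram statements of the tree — the Hex-lemma dichotomy `triLRCrossing_or_compl_triTBCrossing`
(translated: `hPath_or_compl_vPath`) and the crossing lemma `PathIn.tri_crossings_meet` — by
**painting** the complement of the half-annulus inside the parallelogram `[-2, 2m] × [-(2m+1), 2m+1]`
(Bollobás–Riordan 2006, Ch. 7, proofs of Lemma 5 and Claim 23: regions outside the domain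
"coloured black together with the corner"; the tree's `TriHexagon.lean` uses the same device),
resp. by **routing** the two would-be disjoint paths through the inner half-hexagon, the left
half-plane and the rows `x₁ = ± (2m+1)` to the four sides of `[-2m, 2m] × [-(2m+1), 2m+1]`.

## Contents

* Generic helpers: `site_eta`, `triNorm_mk`, `adj_mk_site` (explicit lattice points for `omega`),
  `hPath_or_compl_vPath` (Hex-lemma dichotomy in `[a, a+w] × [b, b+h]`), `pathIn_rowZ`,
  `pathIn_colZ` (straight segments with integer endpoints).
* Namespace `HalfAnnulus`: `haSet`, `haFin` (`↑(haFin m) = haSet m`), `hinSet` (inner half-hexagon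
  `{0 ≤ x₀, |x|_𝕋 < m}`), `wedgeSet` (outer wedge `{x₀ + x₁ > 2m}`); the arcs `IsIntJ`, `IsIntBt`,
  `IsIntTp`; the painting `hBSet`, `b0Set`, `bpSet`, `intPaint` and the white regions `InWup`,
  `InWdn` with their adjacency bookkeeping; `int_dual` (`5 ≤ m`), `int_cut` (`5 ≤ m`; no
  hypothesis that `c` meets `J` only at its tip is needed); `intDom m : JDomain` with
  `intDom_D/J/F/Tp/Bt/ht`, `intDom_dualProp`, `intDom_cutProp`.

## References

* P. Nolin, *Near-critical percolation in two dimensions*, EJP 13 (2008), §4.4, proof of Thm. 11,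
  "2. Internal extremities" and Lemma 15 [arXiv 0711.4948: Thm. 10, Lemma 14, Fig. 8]. [Nolin2008]
* B. Bollobás, O. Riordan, *Percolation*, CUP (2006), Ch. 7, Lemma 5 p. 169 and proof of
  Claim 23 p. 201 (painting); Ch. 5, Lemma 7 (Hex lemma). [BollobasRiordan2006]
* H. Kesten, *Percolation theory for mathematicians* (1982), §2.2–2.3. [KestenPTM1982]

Mathlib search: no lattice-domain topology in Mathlib. Tree: `JDomain` (`TriLowestCrossing.lean`),
`trapDomain` (`ArmSeparationTrapezoid.lean`, the external counterpart), `triNorm_eq_max`,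
`triGraph_adj_iff_coord` (`TriAnnulusCircuit.lean`), `triNorm_le_triNorm_add_one_of_adj`
(`ArmEventsProofs.lean`), `pathIn_hSegment`, `pathIn_vSegment_up` (`ArmSeparationNonvacuity.lean`),
`triStrip`, `mem_triHCross_iff_shift`, `mem_triVCross_iff_shift`, `triHCross_zero_zero`,
`triVCross_zero_zero` (`TriRSWChaining.lean`), `triLRCrossing_or_compl_triTBCrossing`
(`TriHexLemma.lean`), `PathIn.tri_crossings_meet` (`TriCrossingsMeet.lean`), `PathIn.exit(_or)`,
`last_exit` (`SitePaths.lean`).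
-/

noncomputable section

namespace Literature.Probability.Percolation

open LatticeModels

/-! ### Generic path helpers -/

/-- A lattice point from its two coordinates. [folklore] -/
theorem site_eta (v : Site 2) : (![v 0, v 1] : Site 2) = v := by
  ext j; fin_cases j <;> rfl

/-- The hexagonal norm of an explicit lattice point, as nested maxima (for `omega`). [folklore] -/
theorem triNorm_mk (a b : ℤ) :
    triNorm (![a, b] : Site 2) = max (max a (-a)) (max (max b (-b)) (max (a + b) (-(a + b)))) := by
  rw [triNorm_eq_max]; rfl

/-- Adjacency in `𝕋` of an explicit lattice point with a site, from the coordinate relations. [folklore] -/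
theorem adj_mk_site {a b : ℤ} {y : Site 2}
    (h : (y 0 = a + 1 ∧ y 1 = b) ∨ (a = y 0 + 1 ∧ y 1 = b) ∨ (y 1 = b + 1 ∧ y 0 = a) ∨ (b = y 1 + 1 ∧ y 0 = a) ∨
      (y 0 = a + 1 ∧ b = y 1 + 1) ∨ (a = y 0 + 1 ∧ y 1 = b + 1)) :
    triGraph.Adj (![a, b] : Site 2) y :=
  (triGraph_adj_iff_coord _ _).2 h

/-- **The Hex-lemma dichotomy in a translated parallelogram**: every set of sites `χ` either
contains a left–right `𝕋`-path of `[a, a+w] × [b, b+h]` or its complement contains a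
top–bottom `𝕋`-path of it (`triLRCrossing_or_compl_triTBCrossing`, translated). [cite: BollobasRiordan2006, Ch. 5 Lemma 7 p. 131] -/
theorem hPath_or_compl_vPath (a b : ℤ) (w h : ℕ) (χ : Set (Site 2)) :
    (∃ x y : Site 2, x 0 = a ∧ y 0 = a + w ∧ PathIn triGraph (triStrip a b w h ∩ χ) x y) ∨
    (∃ x y : Site 2, x 1 = b ∧ y 1 = b + h ∧ PathIn triGraph (triStrip a b w h ∩ χᶜ) x y) := by
  rcases triLRCrossing_or_compl_triTBCrossing w h (SiteConfig.relabel (Site.shift (-![a, b])) χ) with H | H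
  · left
    rw [← triHCross_zero_zero, ← mem_triHCross_iff_shift] at H
    exact H
  · right
    have hc : (SiteConfig.relabel (Site.shift (-![a, b])) χ)ᶜ = SiteConfig.relabel (Site.shift (-![a, b])) χᶜ := by
      rw [SiteConfig.relabel_apply, SiteConfig.relabel_apply, Set.image_compl_eq (Equiv.bijective _)]
    rw [hc, ← triVCross_zero_zero, ← mem_triVCross_iff_shift] at H
    exact H

/-! ### Straight segments (integer endpoints) -/

/-- A horizontal lattice segment `{(x, y) : a ≤ x ≤ b}` inside `A` is a `𝕋`-path in `A`. [folklore] -/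
theorem pathIn_rowZ {A : Set (Site 2)} (y a b : ℤ) (hab : a ≤ b)
    (h : ∀ x : ℤ, a ≤ x → x ≤ b → (![x, y] : Site 2) ∈ A) : PathIn triGraph A ![a, y] ![b, y] := by
  have key := pathIn_hSegment (A := A) (a := a) (y := y) (b - a).toNat (fun i hi => h _ (by omega)
    (by have := Int.toNat_of_nonneg (sub_nonneg.2 hab); omega))
  have e : a + ((b - a).toNat : ℕ) = b := by rw [Int.toNat_of_nonneg (sub_nonneg.2 hab)]; ring
  rwa [e] at key

/-- A vertical lattice segment `{(x, y) : a ≤ y ≤ b}` inside `A` is a `𝕋`-path in `A`. [folklore] -/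
theorem pathIn_colZ {A : Set (Site 2)} (x a b : ℤ) (hab : a ≤ b)
    (h : ∀ y : ℤ, a ≤ y → y ≤ b → (![x, y] : Site 2) ∈ A) : PathIn triGraph A ![x, a] ![x, b] := by
  have key := pathIn_vSegment_up (A := A) (x := x) (t := a) (b - a).toNat (fun i hi => h _ (by omega)
    (by have := Int.toNat_of_nonneg (sub_nonneg.2 hab); omega))
  have e : a + ((b - a).toNat : ℕ) = b := by rw [Int.toNat_of_nonneg (sub_nonneg.2 hab)]; ring
  rwa [e] at key

namespace HalfAnnulus

/-! ### The half-annulus (coordinate predicates) -/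

/-- The right half-annulus `HA(r) = {0 ≤ x₀, r ≤ |x|_𝕋 ≤ 2r}`: the part of the hexagonal annulus
`{r ≤ |·|_𝕋 ≤ 2r}` in the three sectors of the sides `6, 1, 2` (simply connected; the exploration
region for the internal extremities on the inner side `1`, Nolin 2008, §4.4, `U^{1,int}`). [cite: Nolin2008, §4.4 (arXiv 0711.4948: proof of Thm. 10, regions U)] -/
def haSet (r : ℕ) : Set (Site 2) := {x | 0 ≤ x 0 ∧ (r : ℤ) ≤ triNorm x ∧ triNorm x ≤ 2 * r}

/-- The inner right half-hexagon `{0 ≤ x₀, |x|_𝕋 < r}` (painted in the reductions). [folklore] -/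
def hinSet (r : ℕ) : Set (Site 2) := {x | 0 ≤ x 0 ∧ triNorm x < r}

/-- Membership in `haSet`. [folklore] -/
@[simp] theorem mem_haSet {r : ℕ} {x : Site 2} : x ∈ haSet r ↔ 0 ≤ x 0 ∧ (r : ℤ) ≤ triNorm x ∧ triNorm x ≤ 2 * r :=
  Iff.rfl

/-- Membership in `hinSet`. [folklore] -/
@[simp] theorem mem_hinSet {r : ℕ} {x : Site 2} : x ∈ hinSet r ↔ 0 ≤ x 0 ∧ triNorm x < r := Iff.rfl

/-- The half-annulus as a finite set of sites. [cite: Nolin2008, §4.4 (arXiv 0711.4948: proof of Thm. 10, regions U)] -/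
def haFin (r : ℕ) : Finset (Site 2) := (triBall (2 * r)).filter fun x => 0 ≤ x 0 ∧ (r : ℤ) ≤ triNorm x

/-- Membership in `haFin`. [folklore] -/
@[simp] theorem mem_haFin {r : ℕ} {x : Site 2} : x ∈ haFin r ↔ 0 ≤ x 0 ∧ (r : ℤ) ≤ triNorm x ∧ triNorm x ≤ 2 * r := by
  simp only [haFin, Finset.mem_filter, mem_triBall_iff, Nat.cast_mul, Nat.cast_ofNat]
  tauto

/-- `↑(haFin r) = haSet r`. [folklore] -/
@[simp] theorem coe_haFin (r : ℕ) : (↑(haFin r) : Set (Site 2)) = haSet r := by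
  ext x; simp

/-- The outer wedge `{0 ≤ x₀ ≤ 2r, x₁ ≤ 2r, x₀ + x₁ > 2r}` beyond the outer side `2` (painted
black in the duality reduction, used for extensions in the cut reduction). [folklore] -/
def wedgeSet (r : ℕ) : Set (Site 2) :=
  {x | 0 ≤ x 0 ∧ x 0 ≤ 2 * r ∧ x 1 ≤ 2 * r ∧ 2 * (r : ℤ) < x 0 + x 1}

/-- Membership in `wedgeSet`. [folklore] -/
@[simp] theorem mem_wedgeSet {r : ℕ} {x : Site 2} :
    x ∈ wedgeSet r ↔ 0 ≤ x 0 ∧ x 0 ≤ 2 * r ∧ x 1 ≤ 2 * r ∧ 2 * (r : ℤ) < x 0 + x 1 := Iff.rfl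

/-! ### Internal extremities: the arcs -/

/-- The lower reference arc for internal extremities: the inner side `6` together with the three
lowest sites of the inner side `1`. [cite: Nolin2008, §4.4 (arXiv 0711.4948: proof of Thm. 10, regions U^{int})] -/
def IsIntBt (m : ℕ) (s : Site 2) : Prop :=
  triNorm s = m ∧ (s 1 = -(m : ℤ) ∨ (s 0 = m ∧ s 1 ≤ -(m : ℤ) + 2))

/-- The upper reference arc for internal extremities: the inner side `2` together with the three
highest sites of the inner side `1`. [cite: Nolin2008, §4.4 (arXiv 0711.4948: proof of Thm. 10, regions U^{int})] -/
def IsIntTp (m : ℕ) (e : Site 2) : Prop :=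
  triNorm e = m ∧ ((0 ≤ e 1 ∧ e 0 + e 1 = m) ∨ (e 0 = m ∧ -2 ≤ e 1))

/-- The tip arc for internal extremities: the inner side `1` without its two extreme sites at
each end, `{(m, y) : -m + 2 ≤ y ≤ -2}`; its end sites `(m, -m+2)`, `(m, -2)` also belong to the
reference arcs `IsIntBt`, `IsIntTp`. [cite: Nolin2008, §4.4 (arXiv 0711.4948: proof of Thm. 10, regions U^{int})] -/
def IsIntJ (m : ℕ) (z : Site 2) : Prop := z 0 = m ∧ -(m : ℤ) + 2 ≤ z 1 ∧ z 1 ≤ -2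

/-! ### Internal extremities: duality by painting -/

/-- The black core behind the tip arc: the sites of the inner half-hexagon in the sector of the
side `1` all of whose neighbours in the half-annulus lie on the tip arc. [folklore] -/
def hBSet (m : ℕ) : Set (Site 2) :=
  {x | 0 ≤ x 0 ∧ triNorm x < m ∧ x 1 ≤ 0 ∧ 0 ≤ x 0 + x 1 ∧
    ¬ (x 0 = (m : ℤ) - 1 ∧ (x 1 = 0 ∨ x 1 = -1 ∨ x 1 = -(m : ℤ) + 1 ∨ x 1 = -(m : ℤ) + 2))}

/-- Membership in `hBSet`. [folklore] -/
@[simp] theorem mem_hBSet {m : ℕ} {x : Site 2} : x ∈ hBSet m ↔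
    0 ≤ x 0 ∧ triNorm x < m ∧ x 1 ≤ 0 ∧ 0 ≤ x 0 + x 1 ∧
    ¬ (x 0 = (m : ℤ) - 1 ∧ (x 1 = 0 ∨ x 1 = -1 ∨ x 1 = -(m : ℤ) + 1 ∨ x 1 = -(m : ℤ) + 2)) := Iff.rfl

/-- The black source: the core together with the two collar sites `(-2, 0)`, `(-1, 0)`. [folklore] -/
def b0Set (m : ℕ) : Set (Site 2) := {x | (x 0 = -2 ∧ x 1 = 0) ∨ (x 0 = -1 ∧ x 1 = 0) ∨ x ∈ hBSet m}

/-- Membership in `b0Set`. [folklore] -/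
@[simp] theorem mem_b0Set {m : ℕ} {x : Site 2} :
    x ∈ b0Set m ↔ (x 0 = -2 ∧ x 1 = 0) ∨ (x 0 = -1 ∧ x 1 = 0) ∨ x ∈ hBSet m := Iff.rfl

/-- The remaining black paint: insulating columns facing the cut rays, the outer wedge, and the
two extra rows `x₁ = ± (2m + 1)` over `x₀ ≥ -1`. [folklore] -/
def bpSet (m : ℕ) : Set (Site 2) :=
  {x | (x 0 = -1 ∧ (m : ℤ) ≤ x 1) ∨ (x 0 = -1 ∧ x 1 ≤ -(m : ℤ) + 1) ∨ x ∈ wedgeSet m ∨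
    (-1 ≤ x 0 ∧ (x 1 = 2 * m + 1 ∨ x 1 = -(2 * (m : ℤ) + 1)))}

/-- Membership in `bpSet`. [folklore] -/
@[simp] theorem mem_bpSet {m : ℕ} {x : Site 2} : x ∈ bpSet m ↔
    (x 0 = -1 ∧ (m : ℤ) ≤ x 1) ∨ (x 0 = -1 ∧ x 1 ≤ -(m : ℤ) + 1) ∨ x ∈ wedgeSet m ∨
    (-1 ≤ x 0 ∧ (x 1 = 2 * m + 1 ∨ x 1 = -(2 * (m : ℤ) + 1))) := Iff.rfl

/-- **The painting for the internal duality** (black part). [cite: BollobasRiordan2006, Ch. 7 proof of Claim 23 p. 201] -/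
def intPaint (m : ℕ) : Set (Site 2) := b0Set m ∪ bpSet m

/-- The upper white region: upper collar chimney, upper inner half-hexagon and the two core-excluded
sites next to the top of the tip arc. [folklore] -/
def InWup (m : ℕ) (v : Site 2) : Prop :=
  (v 0 = -2 ∧ 1 ≤ v 1) ∨ (v 0 = -1 ∧ 1 ≤ v 1 ∧ v 1 ≤ (m : ℤ) - 1) ∨
    (0 ≤ v 0 ∧ triNorm v < m ∧ (1 ≤ v 1 ∨ (v 0 = (m : ℤ) - 1 ∧ (v 1 = 0 ∨ v 1 = -1))))

/-- The lower white region (mirror of `InWup`). [folklore] -/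
def InWdn (m : ℕ) (v : Site 2) : Prop :=
  (v 0 = -2 ∧ v 1 ≤ -1) ∨ (v 0 = -1 ∧ -(m : ℤ) + 2 ≤ v 1 ∧ v 1 ≤ -1) ∨
    (0 ≤ v 0 ∧ triNorm v < m ∧ (v 0 + v 1 ≤ -1 ∨ (v 0 = (m : ℤ) - 1 ∧ (v 1 = -(m : ℤ) + 1 ∨ v 1 = -(m : ℤ) + 2))))

section IntDual

variable {m : ℕ}

/-- White sites of the painted parallelogram off the half-annulus are in one of the two white
regions. [folklore] -/
theorem inWup_or_inWdn_of_white {v : Site 2}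
    (hbox : -2 ≤ v 0 ∧ v 0 ≤ 2 * m ∧ -(2 * (m : ℤ) + 1) ≤ v 1 ∧ v 1 ≤ 2 * m + 1)
    (hP : v ∉ intPaint m) (hH : v ∉ haSet m) : InWup m v ∨ InWdn m v := by
  simp only [intPaint, Set.mem_union, mem_b0Set, mem_bpSet, mem_hBSet, mem_wedgeSet, not_or] at hP
  simp only [mem_haSet, not_and, not_le] at hH
  unfold InWup InWdn
  obtain ⟨⟨hP1, hP2, hP3⟩, hP4, hP5, hP6, hP7⟩ := hP
  by_cases hv0 : 0 ≤ v 0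
  · have hN : triNorm v < m := by
      by_contra hN
      push Not at hN
      have hN2 : 2 * (m : ℤ) < triNorm v := hH hv0 hN
      rw [triNorm_eq_max] at hN2
      omega
    simp only [not_and] at hP3
    have hP3' := hP3 hv0 hN
    by_cases h1 : 1 ≤ v 1
    · left; right; right; exact ⟨hv0, hN, Or.inl h1⟩
    by_cases h2 : v 0 + v 1 ≤ -1
    · right; right; right; exact ⟨hv0, hN, Or.inl h2⟩
    have h3 := hP3' (by omega) (by omega)
    push Not at h3
    obtain ⟨h3a, h3b⟩ := h3
    rcases h3b with h | h | h | h
    · left; right; right; exact ⟨hv0, hN, Or.inr ⟨h3a, Or.inl h⟩⟩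
    · left; right; right; exact ⟨hv0, hN, Or.inr ⟨h3a, Or.inr h⟩⟩
    · right; right; right; exact ⟨hv0, hN, Or.inr ⟨h3a, Or.inl h⟩⟩
    · right; right; right; exact ⟨hv0, hN, Or.inr ⟨h3a, Or.inr h⟩⟩
  · by_cases hv0' : v 0 = -1
    · have h4 : ¬ (m : ℤ) ≤ v 1 := fun h => hP4 ⟨hv0', h⟩
      have h5 : ¬ v 1 ≤ -(m : ℤ) + 1 := fun h => hP5 ⟨hv0', h⟩
      have h2 : v 1 ≠ 0 := fun h => hP2 ⟨hv0', h⟩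
      rcases lt_or_gt_of_ne h2 with h | h
      · right; right; left; exact ⟨hv0', by omega, by omega⟩
      · left; right; left; exact ⟨hv0', by omega, by omega⟩
    · have hv0'' : v 0 = -2 := by omega
      have h2 : v 1 ≠ 0 := fun h => hP1 ⟨hv0'', h⟩
      rcases lt_or_gt_of_ne h2 with h | h
      · right; left; exact ⟨hv0'', by omega⟩
      · left; left; exact ⟨hv0'', by omega⟩

/-- The two white regions are not adjacent (for `m ≥ 5`). [folklore] -/
theorem not_adj_inWup_inWdn (hm : 5 ≤ m) {v w : Site 2} (hv : InWup m v) (hw : InWdn m w)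
    (hvw : triGraph.Adj v w) : False := by
  rw [triGraph_adj_iff_coord] at hvw
  unfold InWup at hv; unfold InWdn at hw
  omega

/-- The white regions lie off the half-annulus. [folklore] -/
theorem not_mem_haSet_of_inWup {v : Site 2} (hv : InWup m v) : v ∉ haSet m := by
  unfold InWup at hv; simp only [mem_haSet, not_and, not_le]; intros; omega

/-- The white regions lie off the half-annulus. [folklore] -/
theorem not_mem_haSet_of_inWdn {v : Site 2} (hv : InWdn m v) : v ∉ haSet m := by
  unfold InWdn at hv; simp only [mem_haSet, not_and, not_le]; intros; omega

/-- Half-annulus neighbours of the upper white region lie on the upper reference arc. [folklore] -/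
theorem isIntTp_of_adj_inWup (hm : 5 ≤ m) {v w : Site 2} (hv : InWup m v) (hw : w ∈ haSet m)
    (hvw : triGraph.Adj v w) : IsIntTp m w := by
  have hN1 := triNorm_le_triNorm_add_one_of_adj hvw
  rw [triGraph_adj_iff_coord] at hvw
  unfold InWup at hv
  obtain ⟨hw0, hwN, -⟩ := hw
  unfold IsIntTp
  have hwN' : triNorm w = m := by
    rcases hv with hv | hv | hv
    · omega
    · rw [triNorm_eq_max] at hwN ⊢; omega
    · omega
  refine ⟨hwN', ?_⟩
  rw [triNorm_eq_max] at hwN'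
  rcases hv with hv | hv | ⟨hv0, hvN, hv1⟩
  · omega
  · omega
  · rw [triNorm_eq_max] at hvN; omega

/-- Half-annulus neighbours of the lower white region lie on the lower reference arc. [folklore] -/
theorem isIntBt_of_adj_inWdn (hm : 5 ≤ m) {v w : Site 2} (hv : InWdn m v) (hw : w ∈ haSet m)
    (hvw : triGraph.Adj v w) : IsIntBt m w := by
  have hN1 := triNorm_le_triNorm_add_one_of_adj hvw
  rw [triGraph_adj_iff_coord] at hvw
  unfold InWdn at hv
  obtain ⟨hw0, hwN, -⟩ := hw
  unfold IsIntBt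
  have hwN' : triNorm w = m := by
    rcases hv with hv | hv | hv
    · omega
    · rw [triNorm_eq_max] at hwN ⊢; omega
    · omega
  refine ⟨hwN', ?_⟩
  rw [triNorm_eq_max] at hwN'
  rcases hv with hv | hv | ⟨hv0, hvN, hv1⟩
  · omega
  · omega
  · rw [triNorm_eq_max] at hvN; omega

/-- A black neighbour, off the source, of a source site lies in `S` on the tip arc. [folklore] -/
theorem isIntJ_of_adj_b0 (hm : 5 ≤ m) {S : Set (Site 2)} (hS : S ⊆ haSet m) {a b : Site 2}
    (ha : a ∈ b0Set m) (hb : b ∈ S ∪ intPaint m) (hb0 : b ∉ b0Set m) (hab : triGraph.Adj a b) :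
    b ∈ S ∧ IsIntJ m b := by
  have hN1 := triNorm_le_triNorm_add_one_of_adj hab
  rw [triGraph_adj_iff_coord] at hab
  simp only [mem_b0Set, mem_hBSet] at ha
  have hbS : b ∈ S := by
    rcases hb with hb | hb
    · exact hb
    · exfalso
      rcases hb with hb | hb
      · exact hb0 hb
      · simp only [mem_bpSet, mem_wedgeSet] at hb
        rcases ha with ha | ha | ⟨ha0, haN, ha1, ha2, -⟩
        · omega
        · omega
        · rw [triNorm_eq_max] at haN; omega
  refine ⟨hbS, ?_⟩
  obtain ⟨hb0', hbN, -⟩ := hS hbS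
  unfold IsIntJ
  rcases ha with ha | ha | ⟨ha0, haN, ha1, ha2, ha3⟩
  · omega
  · rw [triNorm_eq_max] at hbN; omega
  · rw [triNorm_eq_max] at hbN haN; omega

/-- Half-annulus neighbours of the remaining black paint lie on the start set (outer boundary or
cut rays). [folklore] -/
theorem start_of_adj_bp {a b : Site 2} (ha : a ∈ haSet m) (hb : b ∈ bpSet m)
    (hab : triGraph.Adj a b) : a 0 = 0 ∨ triNorm a = 2 * m := by
  rw [triGraph_adj_iff_coord] at hab
  simp only [mem_bpSet, mem_wedgeSet] at hb
  obtain ⟨ha0, haN, haN'⟩ := ha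
  rw [triNorm_eq_max] at haN haN' ⊢
  omega

/-- **Internal duality** (`JDomain.DualProp` for tips on the inner side `1`): for `S ⊆ HA(m)`
(`m ≥ 5`), either `S` contains a `𝕋`-path from the outer boundary or a cut ray to the tip arc
`{(m, y) : -m+2 ≤ y ≤ -2}`, or `HA(m) ∖ S` contains a `𝕋`-path from the lower reference arc to the
upper one. Painting reduction to the Hex-lemma dichotomy in `[-2, 2m] × [-(2m+1), 2m+1]`. [cite: BollobasRiordan2006, Ch. 7 Lemma 5 p. 169] -/
theorem int_dual (hm : 5 ≤ m) (S : Set (Site 2)) (hS : S ⊆ haSet m) :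
    (∃ f z : Site 2, (f 0 = 0 ∨ triNorm f = 2 * m) ∧ IsIntJ m z ∧ PathIn triGraph S f z) ∨
    (∃ s e : Site 2, IsIntBt m s ∧ IsIntTp m e ∧ PathIn triGraph (haSet m \ S) s e) := by
  set χ : Set (Site 2) := S ∪ intPaint m with hχ
  set Bx : Set (Site 2) := triStrip (-2) (-(2 * (m : ℤ) + 1)) (2 * m + 2) (4 * m + 2) with hBx
  have hbox : ∀ v : Site 2, v ∈ Bx ↔
      -2 ≤ v 0 ∧ v 0 ≤ 2 * m ∧ -(2 * (m : ℤ) + 1) ≤ v 1 ∧ v 1 ≤ 2 * m + 1 := by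
    intro v; rw [hBx]; simp only [mem_triStrip]; push_cast; constructor <;> intro h <;> omega
  rcases hPath_or_compl_vPath (-2) (-(2 * (m : ℤ) + 1)) (2 * m + 2) (4 * m + 2) χ with
    ⟨x, y, hx0, hy0, hp⟩ | ⟨x, y, hx1, hy1, hp⟩
  · -- a black left-right path
    left
    have hy0' : y 0 = 2 * m := by rw [hy0]; push_cast; ring
    have hxχ := hp.left_mem
    have hxB : x ∈ b0Set m := by
      rcases hxχ.2 with h | h | h
      · have := hS h; simp only [mem_haSet] at this; omega
      · exact h
      · exfalso; simp only [mem_bpSet, mem_wedgeSet] at h; omega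
    have hyB : y ∉ b0Set m := by
      intro h
      simp only [mem_b0Set, mem_hBSet, triNorm_eq_max] at h
      omega
    obtain ⟨a, b, haB, -, hbB, hab, hq⟩ := hp.last_exit (C := b0Set m) hxB hyB
    obtain ⟨hbS, hbJ⟩ := isIntJ_of_adj_b0 hm hS haB hq.left_mem.1.2 hbB hab
    -- from `b`, follow the path inside `S` off the start set until it first meets the start set
    set R : Set (Site 2) := {v | v ∈ S ∧ ¬ (v 0 = 0 ∨ triNorm v = 2 * m)} with hR
    have hbR : b ∈ R := by
      refine ⟨hbS, ?_⟩
      unfold IsIntJ at hbJ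
      rw [triNorm_eq_max]
      omega
    rcases hq.exit_or (R := R) hbR with hq' | ⟨a', b', ha'R, hb'R, hb'A, ha'b', hq'⟩
    · exfalso
      have hy := hq'.right_mem.1
      have h1 := (hS hy.1).2.2
      have h2 := hy.2
      rw [triNorm_eq_max] at h1 h2
      omega
    · have hpath : PathIn triGraph S b a' := hq'.mono fun v hv => hv.1.1
      have ha'S : a' ∈ S := ha'R.1
      have hb'S : b' ∈ S := by
        rcases hb'A.1.2 with h | h | h
        · exact h
        · exact absurd h hb'A.2
        · exfalso
          have := start_of_adj_bp (hS ha'S) h ha'b'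
          exact ha'R.2 this
      have hb'F : b' 0 = 0 ∨ triNorm b' = 2 * m := by
        by_contra h
        exact hb'R ⟨hb'S, h⟩
      exact ⟨b', b, hb'F, hbJ, (hpath.tail ha'b' hb'S).symm⟩
  · -- a white top-bottom path, from the lower chimney to the upper chimney
    right
    have hy1' : y 1 = 2 * m + 1 := by rw [hy1]; push_cast; ring
    set A : Set (Site 2) := Bx ∩ χᶜ with hA
    have hmemA : ∀ v, v ∈ A ↔ (-2 ≤ v 0 ∧ v 0 ≤ 2 * m ∧ -(2 * (m : ℤ) + 1) ≤ v 1 ∧ v 1 ≤ 2 * m + 1) ∧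
        v ∉ S ∧ v ∉ intPaint m := by
      intro v
      rw [hA, Set.mem_inter_iff, hbox v, Set.mem_compl_iff, hχ, Set.mem_union, not_or]
    have hwhite : ∀ v, v ∈ A → v ∉ haSet m → InWup m v ∨ InWdn m v := fun v hv hvH =>
      inWup_or_inWdn_of_white ((hmemA v).1 hv).1 ((hmemA v).1 hv).2.2 hvH
    have hxA := (hmemA x).1 hp.left_mem
    have hyA := (hmemA y).1 hp.right_mem
    have hx0 : x 0 = -2 := by
      obtain ⟨hxb, hxS, hxP⟩ := hxA
      simp only [intPaint, Set.mem_union, mem_b0Set, mem_bpSet, not_or] at hxP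
      by_contra h
      exact hxP.2.2.2.2 ⟨by omega, Or.inr hx1⟩
    have hy0 : y 0 = -2 := by
      obtain ⟨hyb, hyS, hyP⟩ := hyA
      simp only [intPaint, Set.mem_union, mem_b0Set, mem_bpSet, not_or] at hyP
      by_contra h
      exact hyP.2.2.2.2 ⟨by omega, Or.inl hy1'⟩
    have hxdn : InWdn m x := Or.inl ⟨hx0, by omega⟩
    have hyup : InWup m y := Or.inl ⟨hy0, by omega⟩
    have hxup : ¬ InWup m x := by unfold InWup; rw [triNorm_eq_max]; omega
    -- first entrance into the upper white region
    obtain ⟨a, b, haup, hbup, hbA, hab, hq⟩ := hp.exit (R := {v | ¬ InWup m v}) hxup (fun h => h hyup)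
    simp only [Set.mem_setOf_eq, not_not] at hbup
    have haA : a ∈ A := hq.right_mem.2
    have haH : a ∈ haSet m := by
      by_contra haH
      rcases hwhite a haA haH with h | h
      · exact haup h
      · exact not_adj_inWup_inWdn hm hbup h hab.symm
    have haTp : IsIntTp m a := isIntTp_of_adj_inWup hm hbup haH hab.symm
    -- last exit from the lower white region
    have hadn : a ∉ {v | InWdn m v} := fun h => not_mem_haSet_of_inWdn h haH
    obtain ⟨a', b', ha'dn, -, hb'dn, ha'b', hq'⟩ := hq.last_exit (C := {v | InWdn m v}) hxdn hadn
    simp only [Set.mem_setOf_eq] at ha'dn hb'dn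
    have hsub : ∀ v, v ∈ ({v | ¬ InWup m v} ∩ A) \ {v | InWdn m v} → v ∈ haSet m \ S := by
      rintro v ⟨⟨hvup, hvA⟩, hvdn⟩
      simp only [Set.mem_setOf_eq] at hvup hvdn
      have hvH : v ∈ haSet m := by
        by_contra hvH
        rcases hwhite v hvA hvH with h | h
        · exact hvup h
        · exact hvdn h
      exact ⟨hvH, ((hmemA v).1 hvA).2.1⟩
    have hb'H : b' ∈ haSet m := (hsub b' hq'.left_mem).1
    have hb'Bt : IsIntBt m b' := isIntBt_of_adj_inWdn hm ha'dn hb'H ha'b'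
    exact ⟨b', a, hb'Bt, haTp, hq'.mono hsub⟩

end IntDual

/-! ### Internal extremities: crossings cut the half-annulus -/

section IntCut

variable {m : ℕ}

/-- A row of the inner half-hexagon: from the cut line `x₀ = 0` to any of its sites. [folklore] -/
theorem pathIn_hin_row {g : Site 2} (hg : g ∈ hinSet m) :
    PathIn triGraph {v : Site 2 | v ∈ hinSet m ∧ v 1 = g 1} ![0, g 1] g := by
  have key := pathIn_rowZ (A := {v : Site 2 | v ∈ hinSet m ∧ v 1 = g 1}) (g 1) 0 (g 0) hg.1 (fun x hx hx' => ?_)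
  · rwa [site_eta] at key
  · have := hg.2
    rw [triNorm_eq_max] at this
    refine ⟨⟨by simp only [Matrix.cons_val_zero]; omega, ?_⟩, rfl⟩
    rw [triNorm_mk]; omega

/-- The inner neighbour `(m - 1, t)` of a site `(m, t)` of the tip arc. [folklore] -/
theorem gz_spec (hm : 5 ≤ m) {z : Site 2} (hz : IsIntJ m z) :
    (![(m : ℤ) - 1, z 1] : Site 2) ∈ hinSet m ∧ triGraph.Adj ![(m : ℤ) - 1, z 1] z := by
  unfold IsIntJ at hz
  refine ⟨⟨by simp only [Matrix.cons_val_zero]; omega, by rw [triNorm_mk]; omega⟩, ?_⟩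
  exact adj_mk_site (by omega)

/-- An inner neighbour, strictly lower than the tip, of a site of the lower reference arc or of
the tip arc below the tip. [folklore] -/
theorem exists_hin_adj_below (hm : 5 ≤ m) {z s : Site 2} (hz : IsIntJ m z) (hsH : s ∈ haSet m)
    (hs : IsIntBt m s ∨ (s 0 = m ∧ -(m : ℤ) + 2 ≤ s 1 ∧ s 1 < z 1)) (hsz : s ≠ z) :
    ∃ g : Site 2, g ∈ hinSet m ∧ triGraph.Adj g s ∧ -(m : ℤ) + 1 ≤ g 1 ∧ g 1 < z 1 := by
  unfold IsIntJ at hz; unfold IsIntBt at hs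
  have hs0 := hsH.1
  have hne : ¬ (s 0 = z 0 ∧ s 1 = z 1) := fun h => hsz (Site.eq_iff_two.2 h)
  -- coordinates of `s`, without norms
  have hco : (s 1 = -(m : ℤ) ∧ s 0 ≤ m) ∨ (s 0 = m ∧ -(m : ℤ) + 1 ≤ s 1 ∧ s 1 < z 1) := by
    rcases hs with ⟨hN, h | h⟩ | h
    · left; rw [triNorm_eq_max] at hN; exact ⟨h, by omega⟩
    · by_cases h1 : s 1 = -(m : ℤ)
      · left; exact ⟨h1, le_of_eq h.1⟩
      · right; rw [triNorm_eq_max] at hN; exact ⟨h.1, by omega, by omega⟩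
    · right; exact ⟨h.1, by omega, h.2.2⟩
  clear hs hsH
  rcases hco with ⟨h1, h0'⟩ | ⟨h0, h1, h1'⟩
  · by_cases h0 : s 0 = m
    · refine ⟨![(m : ℤ) - 1, -(m : ℤ) + 1], ⟨by simp only [Matrix.cons_val_zero]; omega,
        by rw [triNorm_mk]; omega⟩, adj_mk_site (by omega), by simp, ?_⟩
      simp only [Matrix.cons_val_one, Matrix.cons_val_fin_one]; omega
    · refine ⟨![s 0, -(m : ℤ) + 1], ⟨by simp only [Matrix.cons_val_zero]; omega,
        by rw [triNorm_mk]; omega⟩, adj_mk_site (by omega), by simp, ?_⟩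
      simp only [Matrix.cons_val_one, Matrix.cons_val_fin_one]; omega
  · refine ⟨![(m : ℤ) - 1, s 1], ⟨by simp only [Matrix.cons_val_zero]; omega,
      by rw [triNorm_mk]; omega⟩, adj_mk_site (by omega), ?_, ?_⟩
    · simp only [Matrix.cons_val_one, Matrix.cons_val_fin_one]; omega
    · simp only [Matrix.cons_val_one, Matrix.cons_val_fin_one]; omega

/-- An inner neighbour, strictly higher than the tip, of a site of the upper reference arc or of
the tip arc above the tip. [folklore] -/
theorem exists_hin_adj_above (hm : 5 ≤ m) {z e : Site 2} (hz : IsIntJ m z) (heH : e ∈ haSet m)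
    (he : IsIntTp m e ∨ (e 0 = m ∧ z 1 < e 1 ∧ e 1 ≤ -2)) (hez : e ≠ z) :
    ∃ g : Site 2, g ∈ hinSet m ∧ triGraph.Adj g e ∧ z 1 < g 1 ∧ g 1 ≤ (m : ℤ) - 1 := by
  unfold IsIntJ at hz; unfold IsIntTp at he
  have he0 := heH.1
  have hne : ¬ (e 0 = z 0 ∧ e 1 = z 1) := fun h => hez (Site.eq_iff_two.2 h)
  have hco : (1 ≤ e 1 ∧ e 0 + e 1 = m) ∨ (e 0 = m ∧ z 1 < e 1 ∧ e 1 ≤ 0) := by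
    rcases he with ⟨hN, h | h⟩ | h
    · by_cases h0 : e 0 = m
      · right; exact ⟨h0, by omega, by omega⟩
      · left; exact ⟨by omega, h.2⟩
    · right; rw [triNorm_eq_max] at hN; exact ⟨h.1, by omega, by omega⟩
    · right; exact ⟨h.1, h.2.1, by omega⟩
  clear he heH
  rcases hco with ⟨h1, hsum⟩ | ⟨h0, h1, h1'⟩
  · refine ⟨![e 0, e 1 - 1], ⟨by simp only [Matrix.cons_val_zero]; omega,
      by rw [triNorm_mk]; omega⟩, adj_mk_site (by omega), ?_, ?_⟩
    · simp only [Matrix.cons_val_one, Matrix.cons_val_fin_one]; omega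
    · simp only [Matrix.cons_val_one, Matrix.cons_val_fin_one]; omega
  · refine ⟨![(m : ℤ) - 1, e 1], ⟨by simp only [Matrix.cons_val_zero]; omega,
      by rw [triNorm_mk]; omega⟩, adj_mk_site (by omega), ?_, ?_⟩
    · simp only [Matrix.cons_val_one, Matrix.cons_val_fin_one]; omega
    · simp only [Matrix.cons_val_one, Matrix.cons_val_fin_one]; omega

/-- Meeting of a left–right and a top–bottom path of `[-2m, 2m] × [-(2m+1), 2m+1]` living in
disjoint sets is absurd (`PathIn.tri_crossings_meet`). [folklore] -/
theorem absurd_of_lr_tb {A A' : Set (Site 2)} {a b c d : Site 2}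
    (hA : ∀ v ∈ A, -(2 * (m : ℤ)) ≤ v 0 ∧ v 0 ≤ 2 * m ∧ -(2 * (m : ℤ) + 1) ≤ v 1 ∧ v 1 ≤ 2 * m + 1)
    (hA' : ∀ v ∈ A', -(2 * (m : ℤ)) ≤ v 0 ∧ v 0 ≤ 2 * m ∧ -(2 * (m : ℤ) + 1) ≤ v 1 ∧ v 1 ≤ 2 * m + 1)
    (hK : PathIn triGraph A a b) (ha : a 0 = -(2 * (m : ℤ))) (hb : b 0 = 2 * m)
    (hπ : PathIn triGraph A' c d) (hc : c 1 = -(2 * (m : ℤ) + 1)) (hd : d 1 = 2 * m + 1)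
    (hdisj : ∀ v, v ∈ A → v ∈ A' → False) : False := by
  obtain ⟨v, hv, hv'⟩ := PathIn.tri_crossings_meet hA hA' hK ha hb hπ hc hd
  exact hdisj v hv hv'

/-- **Internal cut property** (`JDomain.CutProp` for tips on the inner side `1`, `m ≥ 5`): a
connected set `c ⊆ HA(m)` through a site `z` of the tip arc and a site of the outer boundary
or of a cut ray separates, inside `HA(m) ∖ c`, the lower reference arc and the part of
the tip arc below `z` from the upper reference arc and the part of the tip arc above `z`. Proof:
the two would-be disjoint paths are extended, through the inner half-hexagon, the left
half-plane and the rows `x₁ = ± (2m+1)`, to a left–right and a top–bottom crossing of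
`[-2m, 2m] × [-(2m+1), 2m+1]` living in disjoint sets — five routings according to the side on
which `c` starts. [cite: KestenPTM1982, §2.3] -/
theorem int_cut (hm : 5 ≤ m) {c : Set (Site 2)} (hc : c ⊆ haSet m) {z : Site 2} (hz : z ∈ c)
    (hzJ : IsIntJ m z) (hconn : ∀ u ∈ c, ∀ v ∈ c, PathIn triGraph c u v)
    {f : Site 2} (hf : f ∈ c) (hfF : f 0 = 0 ∨ triNorm f = 2 * m)
    {s e : Site 2} (hs : IsIntBt m s ∨ (s 0 = m ∧ -(m : ℤ) + 2 ≤ s 1 ∧ s 1 < z 1))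
    (he : IsIntTp m e ∨ (e 0 = m ∧ z 1 < e 1 ∧ e 1 ≤ -2))
    (hp : PathIn triGraph (haSet m \ c) s e) : False := by
  have hzJ' := hzJ; unfold IsIntJ at hzJ'
  obtain ⟨hz0, hz1, hz2⟩ := hzJ'
  have hsH : s ∈ haSet m := hp.left_mem.1
  have heH : e ∈ haSet m := hp.right_mem.1
  have hsz : s ≠ z := fun h => hp.left_mem.2 (h ▸ hz)
  have hez : e ≠ z := fun h => hp.right_mem.2 (h ▸ hz)
  obtain ⟨gs, hgs, hgss, hgs1, hgs2⟩ := exists_hin_adj_below hm hzJ hsH hs hsz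
  obtain ⟨ge, hge, hgee, hge1, hge2⟩ := exists_hin_adj_above hm hzJ heH he hez
  obtain ⟨hgz, hgzz⟩ := gz_spec hm hzJ
  have hgsN := hgs.2; have hgeN := hge.2
  rw [triNorm_eq_max] at hgsN hgeN
  have hfH := hc hf
  -- norms of sites of `c` and of `HA ∖ c`, unfolded once and for all
  have hcb : ∀ v ∈ c, 0 ≤ v 0 ∧ v 0 ≤ 2 * m ∧ -(2 * (m : ℤ)) ≤ v 1 ∧ v 1 ≤ 2 * m ∧
      (m : ℤ) ≤ max (max (v 0) (-v 0)) (max (max (v 1) (-v 1)) (max (v 0 + v 1) (-(v 0 + v 1)))) ∧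
      max (max (v 0) (-v 0)) (max (max (v 1) (-v 1)) (max (v 0 + v 1) (-(v 0 + v 1)))) ≤ 2 * m := by
    intro v hv
    obtain ⟨h0, h1, h2⟩ := hc hv
    rw [triNorm_eq_max] at h1 h2
    exact ⟨h0, by omega, by omega, by omega, h1, h2⟩
  have hHb : ∀ v ∈ haSet m \ c, 0 ≤ v 0 ∧ v 0 ≤ 2 * m ∧ -(2 * (m : ℤ)) ≤ v 1 ∧ v 1 ≤ 2 * m ∧
      (m : ℤ) ≤ max (max (v 0) (-v 0)) (max (max (v 1) (-v 1)) (max (v 0 + v 1) (-(v 0 + v 1)))) ∧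
      max (max (v 0) (-v 0)) (max (max (v 1) (-v 1)) (max (v 0 + v 1) (-(v 0 + v 1)))) ≤ 2 * m := by
    intro v hv
    obtain ⟨h0, h1, h2⟩ := hv.1
    rw [triNorm_eq_max] at h1 h2
    exact ⟨h0, by omega, by omega, by omega, h1, h2⟩
  -- the three inner rows and the two inner legs
  set t : ℤ := z 1 with ht
  set ys : ℤ := gs 1 with hys
  set ye : ℤ := ge 1 with hye
  set HK : Set (Site 2) := {v | v ∈ hinSet m ∧ v 1 = t} with hHK
  set Hπ : Set (Site 2) := {v | v ∈ hinSet m ∧ (v 1 = ys ∨ v 1 = ye)} with hHπ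
  have hKH : PathIn triGraph (c ∪ HK) ![0, t] z := by
    have h1 : PathIn triGraph (c ∪ HK) ![0, t] ![(m : ℤ) - 1, t] :=
      (pathIn_hin_row hgz).mono fun v hv => Or.inr hv
    exact h1.trans (PathIn.of_adj (Or.inr ⟨hgz, rfl⟩) (Or.inl hz) hgzz)
  have hπH : PathIn triGraph ((haSet m \ c) ∪ Hπ) ![0, ys] ![0, ye] := by
    have h1 : PathIn triGraph ((haSet m \ c) ∪ Hπ) ![0, ys] gs :=
      (pathIn_hin_row hgs).mono fun v hv => Or.inr ⟨hv.1, Or.inl hv.2⟩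
    have h2 : PathIn triGraph ((haSet m \ c) ∪ Hπ) gs s :=
      PathIn.of_adj (Or.inr ⟨hgs, Or.inl rfl⟩) (Or.inl hp.left_mem) hgss
    have h3 : PathIn triGraph ((haSet m \ c) ∪ Hπ) s e := hp.mono fun v hv => Or.inl hv
    have h4 : PathIn triGraph ((haSet m \ c) ∪ Hπ) e ge :=
      PathIn.of_adj (Or.inl hp.right_mem) (Or.inr ⟨hge, Or.inr rfl⟩) hgee.symm
    have h5 : PathIn triGraph ((haSet m \ c) ∪ Hπ) ge ![0, ye] :=
      ((pathIn_hin_row hge).mono fun v hv => Or.inr ⟨hv.1, Or.inr hv.2⟩).symm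
    exact h1.trans (h2.trans (h3.trans (h4.trans h5)))
  -- membership bookkeeping for `HK`, `Hπ`
  have hHKb : ∀ v ∈ HK, 0 ≤ v 0 ∧ v 1 = t ∧
      max (max (v 0) (-v 0)) (max (max (v 1) (-v 1)) (max (v 0 + v 1) (-(v 0 + v 1)))) < m := by
    rintro v ⟨⟨h0, h1⟩, h2⟩; rw [triNorm_eq_max] at h1; exact ⟨h0, h2, h1⟩
  have hHπb : ∀ v ∈ Hπ, 0 ≤ v 0 ∧ (v 1 = ys ∨ v 1 = ye) ∧
      max (max (v 0) (-v 0)) (max (max (v 1) (-v 1)) (max (v 0 + v 1) (-(v 0 + v 1)))) < m := by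
    rintro v ⟨⟨h0, h1⟩, h2⟩; rw [triNorm_eq_max] at h1; exact ⟨h0, h2, h1⟩
  -- which side does `c` start on?
  have hfH' := hfH
  obtain ⟨hf0', hfN1, hfN2⟩ := hfH'
  rw [triNorm_eq_max] at hfN1 hfN2
  rcases hfF with hf0 | hfN
  · by_cases hf1 : (m : ℤ) ≤ f 1
    · ----------------------------------------------------------------
      -- Case C: `f` on the top cut ray.  K: bottom→top, π: left→right.
      ----------------------------------------------------------------
      set LK : Set (Site 2) := {v | (v 0 = -1 ∧ v 1 = t) ∨ (v 0 = -2 ∧ -(2 * (m : ℤ) + 1) ≤ v 1 ∧ v 1 ≤ t) ∨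
        (v 0 = -1 ∧ f 1 ≤ v 1 ∧ v 1 ≤ 2 * m + 1)} with hLK
      set Lπ : Set (Site 2) := {v | (v 1 = ye ∧ -(2 * (m : ℤ)) ≤ v 0 ∧ v 0 ≤ -1) ∨
        (v 0 = -1 ∧ -(2 * (m : ℤ) + 1) ≤ v 1 ∧ v 1 ≤ ys) ∨ (v 1 = -(2 * (m : ℤ) + 1) ∧ -1 ≤ v 0 ∧ v 0 ≤ 2 * m)}
        with hLπ
      set AK : Set (Site 2) := (c ∪ HK) ∪ LK with hAK
      set Aπ : Set (Site 2) := ((haSet m \ c) ∪ Hπ) ∪ Lπ with hAπ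
      -- K : from `(-2, -(2m+1))` to `(-1, 2m+1)`
      have hK : PathIn triGraph AK ![-2, -(2 * (m : ℤ) + 1)] ![-1, 2 * m + 1] := by
        have k1 : PathIn triGraph AK ![-2, -(2 * (m : ℤ) + 1)] ![-2, t] :=
          pathIn_colZ (-2) _ _ (by omega) fun y h1 h2 => Or.inr (Or.inr (Or.inl ⟨rfl, h1, h2⟩))
        have k2 : PathIn triGraph AK ![-2, t] ![0, t] :=
          pathIn_rowZ t (-2) 0 (by norm_num) fun x h1 h2 => by
            rcases lt_trichotomy x (-1) with h | h | h
            · exact Or.inr (Or.inr (Or.inl ⟨by simp; omega, by simp; omega, by simp⟩))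
            · exact Or.inr (Or.inl ⟨by simp [h], rfl⟩)
            · have hx : x = 0 := by omega
              subst hx
              exact Or.inl (Or.inr ⟨⟨le_refl _, by rw [triNorm_mk]; omega⟩, rfl⟩)
        have k3 : PathIn triGraph AK ![0, t] z := hKH.mono fun v hv => Or.inl hv
        have k4 : PathIn triGraph AK z f := (hconn z hz f hf).mono fun v hv => Or.inl (Or.inl hv)
        have k5 : PathIn triGraph AK f ![-1, f 1] :=
          PathIn.of_adj (Or.inl (Or.inl hf)) (Or.inr (Or.inr (Or.inr ⟨rfl, le_refl _, by
            simp only [Matrix.cons_val_one, Matrix.cons_val_fin_one]; omega⟩)))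
            (adj_mk_site (a := -1) (b := f 1) (y := f) (by omega)).symm
        have k6 : PathIn triGraph AK ![-1, f 1] ![-1, 2 * m + 1] :=
          pathIn_colZ (-1) _ _ (by omega) fun y h1 h2 => Or.inr (Or.inr (Or.inr ⟨rfl, h1, h2⟩))
        exact k1.trans (k2.trans (k3.trans (k4.trans (k5.trans k6))))
      -- π : from `(-2m, ye)` to `(2m, -(2m+1))`
      have hπ : PathIn triGraph Aπ ![-(2 * (m : ℤ)), ye] ![2 * m, -(2 * (m : ℤ) + 1)] := by
        have p1 : PathIn triGraph Aπ ![-(2 * (m : ℤ)), ye] ![-1, ye] :=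
          pathIn_rowZ ye _ _ (by omega) fun x h1 h2 => Or.inr (Or.inl ⟨rfl, h1, h2⟩)
        have p2 : PathIn triGraph Aπ ![-1, ye] ![0, ye] := by
          refine PathIn.of_adj (Or.inr (Or.inl ⟨rfl, by simp; omega, by simp⟩))
            (Or.inl (Or.inr ⟨⟨le_refl _, by rw [triNorm_mk]; omega⟩, Or.inr rfl⟩)) ?_
          exact adj_mk_site (by simp)
        have p3 : PathIn triGraph Aπ ![0, ye] ![0, ys] := hπH.symm.mono fun v hv => Or.inl hv
        have p4 : PathIn triGraph Aπ ![0, ys] ![-1, ys] := by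
          refine PathIn.of_adj (Or.inl (Or.inr ⟨⟨le_refl _, by rw [triNorm_mk]; omega⟩, Or.inl rfl⟩))
            (Or.inr (Or.inr (Or.inl ⟨rfl, by simp; omega, by simp⟩))) ?_
          exact adj_mk_site (by simp)
        have p5 : PathIn triGraph Aπ ![-1, ys] ![-1, -(2 * (m : ℤ) + 1)] :=
          (pathIn_colZ (-1) _ _ (by omega) fun y h1 h2 => Or.inr (Or.inr (Or.inl ⟨rfl, h1, h2⟩))).symm
        have p6 : PathIn triGraph Aπ ![-1, -(2 * (m : ℤ) + 1)] ![2 * m, -(2 * (m : ℤ) + 1)] :=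
          pathIn_rowZ _ _ _ (by omega) fun x h1 h2 => Or.inr (Or.inr (Or.inr ⟨rfl, h1, h2⟩))
        exact p1.trans (p2.trans (p3.trans (p4.trans (p5.trans p6))))
      refine absurd_of_lr_tb (m := m) (A := Aπ) (A' := AK) ?_ ?_ hπ (by simp) (by simp) hK (by simp) (by simp) ?_
      · rintro v ((hv | hv) | hv)
        · have := hHb v hv; omega
        · have := hHπb v hv; omega
        · rcases hv with hv | hv | hv <;> omega
      · rintro v ((hv | hv) | hv)
        · have := hcb v hv; omega
        · have := hHKb v hv; omega
        · rcases hv with hv | hv | hv <;> omega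
      · rintro v ((hv | hv) | hv) ((hv' | hv') | hv')
        · exact hv.2 hv'
        · have := hHb v hv; have := hHKb v hv'; omega
        · have := hHb v hv; rcases hv' with hv' | hv' | hv' <;> omega
        · have := hHπb v hv; have := hcb v hv'; omega
        · have := hHπb v hv; have := hHKb v hv'; omega
        · have := hHπb v hv; rcases hv' with hv' | hv' | hv' <;> omega
        · have := hcb v hv'; rcases hv with hv | hv | hv <;> omega
        · have := hHKb v hv'; rcases hv with hv | hv | hv <;> omega
        · rcases hv with hv | hv | hv <;> rcases hv' with hv' | hv' | hv' <;> omega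
    · ----------------------------------------------------------------
      -- Case D: `f` on the bottom cut ray.  K: bottom→top, π: left→right.
      ----------------------------------------------------------------
      have hf1' : f 1 ≤ -(m : ℤ) := by omega
      set LK : Set (Site 2) := {v | (v 0 = -1 ∧ v 1 = t) ∨ (v 0 = -2 ∧ t ≤ v 1 ∧ v 1 ≤ 2 * m + 1) ∨
        (v 0 = -1 ∧ -(2 * (m : ℤ) + 1) ≤ v 1 ∧ v 1 ≤ f 1)} with hLK
      set Lπ : Set (Site 2) := {v | (v 1 = ys ∧ -(2 * (m : ℤ)) ≤ v 0 ∧ v 0 ≤ -1) ∨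
        (v 0 = -1 ∧ ye ≤ v 1 ∧ v 1 ≤ 2 * m + 1) ∨ (v 1 = 2 * (m : ℤ) + 1 ∧ -1 ≤ v 0 ∧ v 0 ≤ 2 * m)}
        with hLπ
      set AK : Set (Site 2) := (c ∪ HK) ∪ LK with hAK
      set Aπ : Set (Site 2) := ((haSet m \ c) ∪ Hπ) ∪ Lπ with hAπ
      have hK : PathIn triGraph AK ![-1, -(2 * (m : ℤ) + 1)] ![-2, 2 * m + 1] := by
        have k1 : PathIn triGraph AK ![-1, -(2 * (m : ℤ) + 1)] ![-1, f 1] :=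
          pathIn_colZ (-1) _ _ (by omega) fun y h1 h2 => Or.inr (Or.inr (Or.inr ⟨rfl, h1, h2⟩))
        have k2 : PathIn triGraph AK ![-1, f 1] f :=
          PathIn.of_adj (Or.inr (Or.inr (Or.inr ⟨rfl, by
            simp only [Matrix.cons_val_one, Matrix.cons_val_fin_one]; omega, le_refl _⟩))) (Or.inl (Or.inl hf))
            (adj_mk_site (by omega))
        have k3 : PathIn triGraph AK f z := (hconn f hf z hz).mono fun v hv => Or.inl (Or.inl hv)
        have k4 : PathIn triGraph AK z ![0, t] := hKH.symm.mono fun v hv => Or.inl hv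
        have k5 : PathIn triGraph AK ![0, t] ![-2, t] :=
          (pathIn_rowZ t (-2) 0 (by norm_num) fun x h1 h2 => by
            rcases lt_trichotomy x (-1) with h | h | h
            · exact Or.inr (Or.inr (Or.inl ⟨by simp; omega, by simp, by simp; omega⟩))
            · exact Or.inr (Or.inl ⟨by simp [h], rfl⟩)
            · have hx : x = 0 := by omega
              subst hx
              exact Or.inl (Or.inr ⟨⟨le_refl _, by rw [triNorm_mk]; omega⟩, rfl⟩)).symm
        have k6 : PathIn triGraph AK ![-2, t] ![-2, 2 * m + 1] :=
          pathIn_colZ (-2) _ _ (by omega) fun y h1 h2 => Or.inr (Or.inr (Or.inl ⟨rfl, h1, h2⟩))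
        exact k1.trans (k2.trans (k3.trans (k4.trans (k5.trans k6))))
      have hπ : PathIn triGraph Aπ ![-(2 * (m : ℤ)), ys] ![2 * m, 2 * (m : ℤ) + 1] := by
        have p1 : PathIn triGraph Aπ ![-(2 * (m : ℤ)), ys] ![-1, ys] :=
          pathIn_rowZ ys _ _ (by omega) fun x h1 h2 => Or.inr (Or.inl ⟨rfl, h1, h2⟩)
        have p2 : PathIn triGraph Aπ ![-1, ys] ![0, ys] := by
          refine PathIn.of_adj (Or.inr (Or.inl ⟨rfl, by simp; omega, by simp⟩))
            (Or.inl (Or.inr ⟨⟨le_refl _, by rw [triNorm_mk]; omega⟩, Or.inl rfl⟩)) ?_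
          exact adj_mk_site (by simp)
        have p3 : PathIn triGraph Aπ ![0, ys] ![0, ye] := hπH.mono fun v hv => Or.inl hv
        have p4 : PathIn triGraph Aπ ![0, ye] ![-1, ye] := by
          refine PathIn.of_adj (Or.inl (Or.inr ⟨⟨le_refl _, by rw [triNorm_mk]; omega⟩, Or.inr rfl⟩))
            (Or.inr (Or.inr (Or.inl ⟨rfl, le_refl _, by simp; omega⟩))) ?_
          exact adj_mk_site (by simp)
        have p5 : PathIn triGraph Aπ ![-1, ye] ![-1, 2 * (m : ℤ) + 1] :=
          pathIn_colZ (-1) _ _ (by omega) fun y h1 h2 => Or.inr (Or.inr (Or.inl ⟨rfl, h1, h2⟩))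
        have p6 : PathIn triGraph Aπ ![-1, 2 * (m : ℤ) + 1] ![2 * m, 2 * (m : ℤ) + 1] :=
          pathIn_rowZ _ _ _ (by omega) fun x h1 h2 => Or.inr (Or.inr (Or.inr ⟨rfl, h1, h2⟩))
        exact p1.trans (p2.trans (p3.trans (p4.trans (p5.trans p6))))
      refine absurd_of_lr_tb (m := m) (A := Aπ) (A' := AK) ?_ ?_ hπ (by simp) (by simp) hK (by simp) (by simp) ?_
      · rintro v ((hv | hv) | hv)
        · have := hHb v hv; omega
        · have := hHπb v hv; omega
        · rcases hv with hv | hv | hv <;> omega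
      · rintro v ((hv | hv) | hv)
        · have := hcb v hv; omega
        · have := hHKb v hv; omega
        · rcases hv with hv | hv | hv <;> omega
      · rintro v ((hv | hv) | hv) ((hv' | hv') | hv')
        · exact hv.2 hv'
        · have := hHb v hv; have := hHKb v hv'; omega
        · have := hHb v hv; rcases hv' with hv' | hv' | hv' <;> omega
        · have := hHπb v hv; have := hcb v hv'; omega
        · have := hHπb v hv; have := hHKb v hv'; omega
        · have := hHπb v hv; rcases hv' with hv' | hv' | hv' <;> omega
        · have := hcb v hv'; rcases hv with hv | hv | hv <;> omega
        · have := hHKb v hv'; rcases hv with hv | hv | hv <;> omega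
        · rcases hv with hv | hv | hv <;> rcases hv' with hv' | hv' | hv' <;> omega
  · rw [triNorm_eq_max] at hfN
    by_cases hfA : f 0 = 2 * m ∨ 0 ≤ f 1
    · ----------------------------------------------------------------
      -- Case A: `f` on the outer side 1 or 2.  K: left→right, π: bottom→top.
      ----------------------------------------------------------------
      set LK : Set (Site 2) := {v | (v 1 = t ∧ -(2 * (m : ℤ)) ≤ v 0 ∧ v 0 ≤ -1) ∨
        (v 1 = f 1 ∧ f 0 < v 0 ∧ v 0 ≤ 2 * m)} with hLK
      set Lπ : Set (Site 2) := {v | (v 0 = -1 ∧ -(2 * (m : ℤ) + 1) ≤ v 1 ∧ v 1 ≤ ys) ∨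
        (v 0 = -1 ∧ ye ≤ v 1 ∧ v 1 ≤ 2 * m + 1)} with hLπ
      set AK : Set (Site 2) := (c ∪ HK) ∪ LK with hAK
      set Aπ : Set (Site 2) := ((haSet m \ c) ∪ Hπ) ∪ Lπ with hAπ
      have hK : PathIn triGraph AK ![-(2 * (m : ℤ)), t] ![2 * m, f 1] := by
        have k1 : PathIn triGraph AK ![-(2 * (m : ℤ)), t] ![-1, t] :=
          pathIn_rowZ t _ _ (by omega) fun x h1 h2 => Or.inr (Or.inl ⟨rfl, h1, h2⟩)
        have k2 : PathIn triGraph AK ![-1, t] ![0, t] := by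
          refine PathIn.of_adj (Or.inr (Or.inl ⟨rfl, by simp; omega, by simp⟩))
            (Or.inl (Or.inr ⟨⟨le_refl _, by rw [triNorm_mk]; omega⟩, rfl⟩)) ?_
          exact adj_mk_site (by simp)
        have k3 : PathIn triGraph AK ![0, t] z := hKH.mono fun v hv => Or.inl hv
        have k4 : PathIn triGraph AK z f := (hconn z hz f hf).mono fun v hv => Or.inl (Or.inl hv)
        have k5 : PathIn triGraph AK f ![2 * m, f 1] := by
          have key := pathIn_rowZ (A := AK) (f 1) (f 0) (2 * m) (by omega) fun x h1 h2 => by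
            rcases eq_or_lt_of_le h1 with h | h
            · subst h; rw [site_eta]; exact Or.inl (Or.inl hf)
            · exact Or.inr (Or.inr ⟨rfl, by simpa using h, by simpa using h2⟩)
          rwa [site_eta] at key
        exact k1.trans (k2.trans (k3.trans (k4.trans k5)))
      have hπ : PathIn triGraph Aπ ![-1, -(2 * (m : ℤ) + 1)] ![-1, 2 * m + 1] := by
        have p1 : PathIn triGraph Aπ ![-1, -(2 * (m : ℤ) + 1)] ![-1, ys] :=
          pathIn_colZ (-1) _ _ (by omega) fun y h1 h2 => Or.inr (Or.inl ⟨rfl, h1, h2⟩)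
        have p2 : PathIn triGraph Aπ ![-1, ys] ![0, ys] := by
          refine PathIn.of_adj (Or.inr (Or.inl ⟨rfl, by simp; omega, by simp⟩))
            (Or.inl (Or.inr ⟨⟨le_refl _, by rw [triNorm_mk]; omega⟩, Or.inl rfl⟩)) ?_
          exact adj_mk_site (by simp)
        have p3 : PathIn triGraph Aπ ![0, ys] ![0, ye] := hπH.mono fun v hv => Or.inl hv
        have p4 : PathIn triGraph Aπ ![0, ye] ![-1, ye] := by
          refine PathIn.of_adj (Or.inl (Or.inr ⟨⟨le_refl _, by rw [triNorm_mk]; omega⟩, Or.inr rfl⟩))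
            (Or.inr (Or.inr ⟨rfl, le_refl _, by simp; omega⟩)) ?_
          exact adj_mk_site (by simp)
        have p5 : PathIn triGraph Aπ ![-1, ye] ![-1, 2 * m + 1] :=
          pathIn_colZ (-1) _ _ (by omega) fun y h1 h2 => Or.inr (Or.inr ⟨rfl, h1, h2⟩)
        exact p1.trans (p2.trans (p3.trans (p4.trans p5)))
      refine absurd_of_lr_tb (m := m) (A := AK) (A' := Aπ) ?_ ?_ hK (by simp) (by simp) hπ (by simp) (by simp) ?_
      · rintro v ((hv | hv) | hv)
        · have := hcb v hv; omega
        · have := hHKb v hv; omega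
        · rcases hv with hv | hv <;> omega
      · rintro v ((hv | hv) | hv)
        · have := hHb v hv; omega
        · have := hHπb v hv; omega
        · rcases hv with hv | hv <;> omega
      · rintro v ((hv | hv) | hv) ((hv' | hv') | hv')
        · exact hv'.2 hv
        · have := hcb v hv; have := hHπb v hv'; omega
        · have := hcb v hv; rcases hv' with hv' | hv' <;> omega
        · have := hHKb v hv; have := hHb v hv'; omega
        · have := hHKb v hv; have := hHπb v hv'; omega
        · have := hHKb v hv; rcases hv' with hv' | hv' <;> omega
        · have := hHb v hv'; rcases hv with hv | hv <;> omega
        · have := hHπb v hv'; rcases hv with hv | hv <;> omega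
        · rcases hv with hv | hv <;> rcases hv' with hv' | hv' <;> omega
    · ----------------------------------------------------------------
      -- Case B: `f` on the outer side 6 (`f₁ = -2m`).  K: bottom→top, π: left→right.
      ----------------------------------------------------------------
      have hf1 : f 1 = -(2 * (m : ℤ)) := by omega
      set LK : Set (Site 2) := {v | (v 0 = f 0 ∧ v 1 = -(2 * (m : ℤ) + 1)) ∨ (v 1 = t ∧ -3 ≤ v 0 ∧ v 0 ≤ -1) ∨
        (v 0 = -3 ∧ t ≤ v 1 ∧ v 1 ≤ 2 * m + 1)} with hLK
      set Lπ : Set (Site 2) := {v | (v 1 = ys ∧ -(2 * (m : ℤ)) ≤ v 0 ∧ v 0 ≤ -1) ∨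
        (v 0 = -1 ∧ ye ≤ v 1 ∧ v 1 ≤ 2 * m + 1) ∨ (v 1 = 2 * (m : ℤ) + 1 ∧ -1 ≤ v 0 ∧ v 0 ≤ 2 * m)}
        with hLπ
      set AK : Set (Site 2) := (c ∪ HK) ∪ LK with hAK
      set Aπ : Set (Site 2) := ((haSet m \ c) ∪ Hπ) ∪ Lπ with hAπ
      have hK : PathIn triGraph AK ![f 0, -(2 * (m : ℤ) + 1)] ![-3, 2 * m + 1] := by
        have k1 : PathIn triGraph AK ![f 0, -(2 * (m : ℤ) + 1)] f :=
          PathIn.of_adj (Or.inr (Or.inl ⟨rfl, rfl⟩)) (Or.inl (Or.inl hf)) (adj_mk_site (by omega))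
        have k2 : PathIn triGraph AK f z := (hconn f hf z hz).mono fun v hv => Or.inl (Or.inl hv)
        have k3 : PathIn triGraph AK z ![0, t] := hKH.symm.mono fun v hv => Or.inl hv
        have k4 : PathIn triGraph AK ![0, t] ![-3, t] :=
          (pathIn_rowZ t (-3) 0 (by norm_num) fun x h1 h2 => by
            rcases eq_or_lt_of_le h2 with h | h
            · subst h
              exact Or.inl (Or.inr ⟨⟨le_refl _, by rw [triNorm_mk]; omega⟩, rfl⟩)
            · exact Or.inr (Or.inr (Or.inl ⟨rfl, by simpa using h1, by simp; omega⟩))).symm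
        have k5 : PathIn triGraph AK ![-3, t] ![-3, 2 * m + 1] :=
          pathIn_colZ (-3) _ _ (by omega) fun y h1 h2 => Or.inr (Or.inr (Or.inr ⟨rfl, h1, h2⟩))
        exact k1.trans (k2.trans (k3.trans (k4.trans k5)))
      have hπ : PathIn triGraph Aπ ![-(2 * (m : ℤ)), ys] ![2 * m, 2 * (m : ℤ) + 1] := by
        have p1 : PathIn triGraph Aπ ![-(2 * (m : ℤ)), ys] ![-1, ys] :=
          pathIn_rowZ ys _ _ (by omega) fun x h1 h2 => Or.inr (Or.inl ⟨rfl, h1, h2⟩)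
        have p2 : PathIn triGraph Aπ ![-1, ys] ![0, ys] := by
          refine PathIn.of_adj (Or.inr (Or.inl ⟨rfl, by simp; omega, by simp⟩))
            (Or.inl (Or.inr ⟨⟨le_refl _, by rw [triNorm_mk]; omega⟩, Or.inl rfl⟩)) ?_
          exact adj_mk_site (by simp)
        have p3 : PathIn triGraph Aπ ![0, ys] ![0, ye] := hπH.mono fun v hv => Or.inl hv
        have p4 : PathIn triGraph Aπ ![0, ye] ![-1, ye] := by
          refine PathIn.of_adj (Or.inl (Or.inr ⟨⟨le_refl _, by rw [triNorm_mk]; omega⟩, Or.inr rfl⟩))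
            (Or.inr (Or.inr (Or.inl ⟨rfl, le_refl _, by simp; omega⟩))) ?_
          exact adj_mk_site (by simp)
        have p5 : PathIn triGraph Aπ ![-1, ye] ![-1, 2 * (m : ℤ) + 1] :=
          pathIn_colZ (-1) _ _ (by omega) fun y h1 h2 => Or.inr (Or.inr (Or.inl ⟨rfl, h1, h2⟩))
        have p6 : PathIn triGraph Aπ ![-1, 2 * (m : ℤ) + 1] ![2 * m, 2 * (m : ℤ) + 1] :=
          pathIn_rowZ _ _ _ (by omega) fun x h1 h2 => Or.inr (Or.inr (Or.inr ⟨rfl, h1, h2⟩))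
        exact p1.trans (p2.trans (p3.trans (p4.trans (p5.trans p6))))
      refine absurd_of_lr_tb (m := m) (A := Aπ) (A' := AK) ?_ ?_ hπ (by simp) (by simp) hK (by simp) (by simp) ?_
      · rintro v ((hv | hv) | hv)
        · have := hHb v hv; omega
        · have := hHπb v hv; omega
        · rcases hv with hv | hv | hv <;> omega
      · rintro v ((hv | hv) | hv)
        · have := hcb v hv; omega
        · have := hHKb v hv; omega
        · rcases hv with hv | hv | hv <;> omega
      · rintro v ((hv | hv) | hv) ((hv' | hv') | hv')
        · exact hv.2 hv'
        · have := hHb v hv; have := hHKb v hv'; omega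
        · have := hHb v hv; rcases hv' with hv' | hv' | hv' <;> omega
        · have := hHπb v hv; have := hcb v hv'; omega
        · have := hHπb v hv; have := hHKb v hv'; omega
        · have := hHπb v hv; rcases hv' with hv' | hv' | hv' <;> omega
        · have := hcb v hv'; rcases hv with hv | hv | hv <;> omega
        · have := hHKb v hv'; rcases hv with hv | hv | hv <;> omega
        · rcases hv with hv | hv | hv <;> rcases hv' with hv' | hv' | hv' <;> omega

end IntCut

/-! ### The `JDomain` of internal extremities -/

section Dom

variable {m : ℕ}

open Classical in
/-- **The exploration domain for internal extremities on the inner side `1`**: the half-annulus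
`HA(m)` with tip arc `IsIntJ` (height `x ↦ x₁`), start set the outer boundary and the cut rays, and
reference arcs `IsIntBt` (below), `IsIntTp` (above) — an instance of the abstract `JDomain` of
`TriLowestCrossing.lean` (Nolin 2008, §4.4, `U^{1,int}_N`; Kesten 1982, §2.3). [cite: Nolin2008, §4.4 (arXiv 0711.4948: proof of Thm. 10, regions U^{int})] -/
def intDom (m : ℕ) : JDomain where
  D := haFin m
  J := (haFin m).filter fun x => IsIntJ m x
  F := (haFin m).filter fun x => x 0 = 0 ∨ triNorm x = 2 * m
  Tp := (haFin m).filter fun x => IsIntTp m x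
  Bt := (haFin m).filter fun x => IsIntBt m x
  ht := fun x => x 1
  J_subset := Finset.filter_subset _ _
  F_subset := Finset.filter_subset _ _
  Tp_subset := Finset.filter_subset _ _
  Bt_subset := Finset.filter_subset _ _
  ht_injOn := by
    intro a ha b hb hab
    simp only [Finset.coe_filter, Set.mem_setOf_eq] at ha hb
    unfold IsIntJ at ha hb
    exact Site.eq_iff_two.2 ⟨by omega, hab⟩

/-- The sites of `intDom`. [folklore] -/
@[simp] theorem intDom_D : (intDom m).D = haFin m := rfl

/-- The height of `intDom`. [folklore] -/
@[simp] theorem intDom_ht (x : Site 2) : (intDom m).ht x = x 1 := rfl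

/-- The tip arc of `intDom`. [folklore] -/
theorem mem_intDom_J {x : Site 2} : x ∈ (intDom m).J ↔ x ∈ haFin m ∧ IsIntJ m x := by
  classical
  show x ∈ (haFin m).filter _ ↔ _
  simp [Finset.mem_filter]

/-- The start set of `intDom`. [folklore] -/
theorem mem_intDom_F {x : Site 2} : x ∈ (intDom m).F ↔ x ∈ haFin m ∧ (x 0 = 0 ∨ triNorm x = 2 * m) := by
  classical
  show x ∈ (haFin m).filter _ ↔ _
  simp [Finset.mem_filter]

/-- The upper reference arc of `intDom`. [folklore] -/
theorem mem_intDom_Tp {x : Site 2} : x ∈ (intDom m).Tp ↔ x ∈ haFin m ∧ IsIntTp m x := by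
  classical
  show x ∈ (haFin m).filter _ ↔ _
  simp [Finset.mem_filter]

/-- The lower reference arc of `intDom`. [folklore] -/
theorem mem_intDom_Bt {x : Site 2} : x ∈ (intDom m).Bt ↔ x ∈ haFin m ∧ IsIntBt m x := by
  classical
  show x ∈ (haFin m).filter _ ↔ _
  simp [Finset.mem_filter]

/-- Coercion of `D ∖ S` for `intDom`. [folklore] -/
theorem coe_intDom_D_sdiff (S : Finset (Site 2)) :
    (↑((intDom m).D \ S) : Set (Site 2)) = haSet m \ ↑S := by
  rw [intDom_D, Finset.coe_sdiff, coe_haFin]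

/-- **Duality holds in the inner half-annulus** (`JDomain.DualProp` for `intDom m`, `m ≥ 5`). [cite: BollobasRiordan2006, Ch. 7 Lemma 5 p. 169] -/
theorem intDom_dualProp (hm : 5 ≤ m) : (intDom m).DualProp := by
  intro S hS
  have hS' : (↑S : Set (Site 2)) ⊆ haSet m := by
    intro v hv; rw [← coe_haFin]; exact Finset.mem_coe.2 (hS (Finset.mem_coe.1 hv))
  rcases int_dual hm (↑S) hS' with ⟨f, z, hfF, hzJ, hp⟩ | ⟨s, e, hs, he, hp⟩
  · left
    have hf : f ∈ S := Finset.mem_coe.1 hp.left_mem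
    have hz : z ∈ S := Finset.mem_coe.1 hp.right_mem
    exact ⟨f, mem_intDom_F.2 ⟨hS hf, hfF⟩, z, mem_intDom_J.2 ⟨hS hz, hzJ⟩, hp⟩
  · right
    have hs' : s ∈ haFin m := by rw [← Finset.mem_coe, coe_haFin]; exact hp.left_mem.1
    have he' : e ∈ haFin m := by rw [← Finset.mem_coe, coe_haFin]; exact hp.right_mem.1
    refine ⟨s, mem_intDom_Bt.2 ⟨hs', hs⟩, e, mem_intDom_Tp.2 ⟨he', he⟩, ?_⟩
    rwa [coe_intDom_D_sdiff]

/-- **Crossings cut the inner half-annulus** (`JDomain.CutProp` for `intDom m`, `m ≥ 5`). [cite: KestenPTM1982, §2.3] -/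
theorem intDom_cutProp (hm : 5 ≤ m) : (intDom m).CutProp := by
  intro c z hc s hs e he hp
  have hcD : (↑c : Set (Site 2)) ⊆ haSet m := by
    intro v hv; rw [← coe_haFin]; exact Finset.mem_coe.2 (hc.subset (Finset.mem_coe.1 hv))
  have hzJ : IsIntJ m z := (mem_intDom_J.1 hc.tip_mem_J).2
  obtain ⟨f, hf, hfF⟩ := hc.exists_start
  have hfF' : f 0 = 0 ∨ triNorm f = 2 * m := (mem_intDom_F.1 hfF).2
  have hs' : IsIntBt m s ∨ (s 0 = m ∧ -(m : ℤ) + 2 ≤ s 1 ∧ s 1 < z 1) := by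
    rcases Finset.mem_union.1 hs with h | h
    · exact Or.inl (mem_intDom_Bt.1 h).2
    · right
      obtain ⟨hJ, hlt⟩ := JDomain.mem_Jbelow.1 h
      have := (mem_intDom_J.1 hJ).2
      unfold IsIntJ at this
      simp only [intDom_ht] at hlt
      exact ⟨this.1, this.2.1, hlt⟩
  have he' : IsIntTp m e ∨ (e 0 = m ∧ z 1 < e 1 ∧ e 1 ≤ -2) := by
    rcases Finset.mem_union.1 he with h | h
    · exact Or.inl (mem_intDom_Tp.1 h).2
    · right
      obtain ⟨hJ, hlt⟩ := JDomain.mem_Jabove.1 h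
      have := (mem_intDom_J.1 hJ).2
      unfold IsIntJ at this
      simp only [intDom_ht] at hlt
      exact ⟨this.1, hlt, this.2.2⟩
  rw [coe_intDom_D_sdiff] at hp
  exact int_cut hm hcD (Finset.mem_coe.2 hc.tip_mem) hzJ
    (fun u hu v hv => hc.conn u (Finset.mem_coe.1 hu) v (Finset.mem_coe.1 hv)) (Finset.mem_coe.2 hf) hfF' hs' he' hp

end Dom

end HalfAnnulus

end Literature.Probability.Percolation
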